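import Literature.AlgebraicGeometry.AbelianSchemes.AbelianSchemeDualTransport
import HarnessLib

/-!
# `Ĥ` IS the dual transport: an `S`-morphism `Ĥ : Â' → Â` with `(e × Ĥ)^*𝒫 ≅ 𝒫'` equals `hatTransport D D' e`
# — the «unique» of [MilneAV2008] I §8 read on the Poincaré clause of [MFK94] Def. 7.3 (sequel of ★ `AbelianSchemeDualTransport`)

Topic `AlgebraicGeometry/AbelianSchemes`; namespace `Literature.AlgebraicGeometry.AbelianSchemes.AbelianSchemeOver.DualPair`.
Cell hodgecm-mathlib (D-0151), rung-0 ladder / M1PRIME-DAG **W3c (c-iii) sub-leaf (K3-a)** (B-p03's § 9 `lamClauseTransportR`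
census, 2026-08-29): in the λ-half `LamClauseTransport` of the triple transport the dual-side morphism `Ĥ` is an ARBITRARY
`S`-morphism carrying exactly the Poincaré clause `(e × Ĥ)^*𝒫 ≅ 𝒫'` of ★ D4 `PolarizedAbelianSchemeWithLevel.IsBaseChangeVia`
along `𝟙 S`; this file identifies it with the dual transport `Ĥ_e = hatTransport D D' e` of ★ `AbelianSchemeDualTransport`
(B-p01), i.e. it reads ★ `nonempty_pullback_map_hatTransport_iso` BACKWARDS through the uniqueness half of the universal
property of the dual (★ D2 `DualPair.eq_classify`).  THEOREMS ONLY (no def, no structure, no named fact, no instance,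
no `sorry`); books 0.  HC_CM is proved only modulo the printed citations until rung 0 closes.

## What is proved
* `transportMap_comp_map` — `(e⁻¹ × 1_{Â'}) ≫ (e × Ĥ) = 1_A × Ĥ : A ×_S Â' → A ×_S Â` for ANY `S`-morphism `Ĥ : Â' → Â`
  (the general form of ★ `transportMapInv_comp_baseChangeToProd`, which is the case `Ĥ = Ĥ_e` composed with `e × 1`);
* `nonempty_pullbackP_iso_transportBundle_of_nonempty_pullback_map_iso` — `(e × Ĥ)^*𝒫 ≅ 𝒫'` ⟹
  `(1_A × Ĥ)^*𝒫 ≅ (e⁻¹ × 1)^*𝒫'` = the transported family ★ `transportBundle D' e`;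
* **`eq_hatTransport_of_nonempty_pullback_map_iso`** — hence `Ĥ = hatTransport D D' e` (★ `eq_classify`: both classify
  the transported family, which is rigidified and fibrewise in `Pic⁰` by ★ `transportBundle_fibrewisePicZero`).

## References
* [MilneAV2008] J. S. Milne, *Abelian Varieties* (v2.00, 2008), I §8 pp. 36–37 (the dual abelian variety: «there is a
  unique regular map `α : T → A^∨` such that `(1 × α)^*𝒫 ≈ ℒ`»).
* [MumfordFogartyKirwan1994] D. Mumford, J. Fogarty, F. Kirwan, *Geometric Invariant Theory*, 3rd ed. (1994), Ch. 6 §2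
  (p. 121) (normalised Poincaré sheaf), Ch. 7 §2 Definition 7.3 (p. 130) (isomorphism of triples: the Poincaré clause).
-/

set_option autoImplicit false

universe u

open CategoryTheory CategoryTheory.Limits AlgebraicGeometry MonoidalCategory

noncomputable section

namespace Literature.AlgebraicGeometry.AbelianSchemes

namespace AbelianSchemeOver

open Literature.AlgebraicGeometry.Motives Literature.AlgebraicGeometry.Modules
open Literature.AlgebraicGeometry.AbelianVarieties
open scoped MonObj

namespace DualPair

variable {S : Scheme.{u}} {A A' : AbelianSchemeOver S} (D : A.DualPair) (D' : A'.DualPair) (e : A'.X ≅ A.X)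
  [IsMonHom e.hom]

omit [IsMonHom e.hom] in
/-- **`(e⁻¹ × 1_{Â'}) ≫ (e × Ĥ) = 1_A × Ĥ`** for any `S`-morphism `Ĥ : Â' → Â` (both sides are determined by their two
projections: `fst ≫ e⁻¹ ≫ e = fst` and `snd ≫ Ĥ`). [cite: MilneAV2008, I §8 pp. 36–37]
[cite: MumfordFogartyKirwan1994, Ch. 7 §2 Definition 7.3 (p. 130)] -/
theorem transportMap_comp_map (Ĥ : D'.hat.X.left ⟶ D.hat.X.left)
    (wG : A'.X.hom ≫ 𝟙 S = e.hom.left ≫ A.X.hom) (wĜ : D'.hat.X.hom ≫ 𝟙 S = Ĥ ≫ D.hat.X.hom) :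
    transportMap D' e ≫ pullback.map A'.X.hom D'.hat.X.hom A.X.hom D.hat.X.hom e.hom.left Ĥ (𝟙 S) wG wĜ =
      A.baseChangeToProd D.hat D'.hat.X.hom Ĥ (wĜ.symm.trans (Category.comp_id _)) := by
  have hee : e.inv.left ≫ e.hom.left = 𝟙 _ := by rw [← Over.comp_left, Iso.inv_hom_id, Over.id_left]
  apply pullback.hom_ext
  · exact (Category.assoc _ _ _).trans
      ((congrArg (fun x => transportMap D' e ≫ x) (pullback.lift_fst _ _ _)).trans
        ((Category.assoc _ _ _).symm.trans
          ((congrArg (fun x => x ≫ e.hom.left) (transportMap_fst D' e)).trans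
            ((Category.assoc _ _ _).trans
              ((congrArg (fun x => pullback.fst A.X.hom D'.hat.X.hom ≫ x) hee).trans
                ((Category.comp_id _).trans (A.baseChangeToProd_fst D.hat D'.hat.X.hom Ĥ _).symm))))))
  · exact (Category.assoc _ _ _).trans
      ((congrArg (fun x => transportMap D' e ≫ x) (pullback.lift_snd _ _ _)).trans
        ((Category.assoc _ _ _).symm.trans
          ((congrArg (fun x => x ≫ Ĥ) (transportMap_snd D' e)).trans
            (A.baseChangeToProd_snd D.hat D'.hat.X.hom Ĥ _).symm)))

/-- **`(e × Ĥ)^*𝒫 ≅ 𝒫'` ⟹ `(1_A × Ĥ)^*𝒫 ≅ (e⁻¹ × 1)^*𝒫'`**, the transported family ★ `transportBundle D' e`: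
pull the given isomorphism back along `e⁻¹ × 1` and use `(e⁻¹ × 1) ≫ (e × Ĥ) = 1 × Ĥ`. [cite: MilneAV2008, I §8 pp. 36–37]
[cite: MumfordFogartyKirwan1994, Ch. 7 §2 Definition 7.3 (p. 130)] -/
theorem nonempty_pullbackP_iso_transportBundle_of_nonempty_pullback_map_iso (Ĥ : D'.hat.X.left ⟶ D.hat.X.left)
    (wG : A'.X.hom ≫ 𝟙 S = e.hom.left ≫ A.X.hom) (wĜ : D'.hat.X.hom ≫ 𝟙 S = Ĥ ≫ D.hat.X.hom)
    (hP : Nonempty ((Scheme.Modules.pullback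
      (pullback.map A'.X.hom D'.hat.X.hom A.X.hom D.hat.X.hom e.hom.left Ĥ (𝟙 S) wG wĜ)).obj D.P ≅ D'.P)) :
    Nonempty (D.pullbackP D'.hat.X.hom Ĥ (wĜ.symm.trans (Category.comp_id _)) ≅ (transportBundle D' e).L) := by
  obtain ⟨i⟩ := hP
  exact ⟨(Scheme.Modules.pullbackCongr (transportMap_comp_map D D' e Ĥ wG wĜ).symm).app D.P ≪≫
    ((Scheme.Modules.pullbackComp _ _).app D.P).symm ≪≫ (Scheme.Modules.pullback (transportMap D' e)).mapIso i⟩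

/-- **(K3-a) `Ĥ` IS THE DUAL TRANSPORT**: an `S`-morphism `Ĥ : Â' → Â` (over `S`: `π̂' = Ĥ ≫ π̂`) such that
`(e × Ĥ)^*𝒫 ≅ 𝒫'` — the Poincaré clause of [MFK94] Def. 7.3 along `𝟙 S` — is the dual transport `Ĥ_e` of
★ `AbelianSchemeDualTransport`: both classify the transported family `(e⁻¹ × 1)^*𝒫'` on `A ×_S Â'`, which is rigidified
and fibrewise in `Pic⁰` (★ `transportBundle_fibrewisePicZero`), so they agree by the uniqueness half of the universal
property of `(Â, 𝒫)` (★ `DualPair.eq_classify`; [MilneAV2008, I §8] «unique»). [cite: MilneAV2008, I §8 pp. 36–37]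
[cite: MumfordFogartyKirwan1994, Ch. 7 §2 Definition 7.3 (p. 130)] -/
theorem eq_hatTransport_of_nonempty_pullback_map_iso (Ĥ : D'.hat.X.left ⟶ D.hat.X.left)
    (wG : A'.X.hom ≫ 𝟙 S = e.hom.left ≫ A.X.hom) (wĜ : D'.hat.X.hom ≫ 𝟙 S = Ĥ ≫ D.hat.X.hom)
    (hP : Nonempty ((Scheme.Modules.pullback
      (pullback.map A'.X.hom D'.hat.X.hom A.X.hom D.hat.X.hom e.hom.left Ĥ (𝟙 S) wG wĜ)).obj D.P ≅ D'.P)) :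
    Ĥ = hatTransport D D' e :=
  D.eq_classify D'.hat.X.hom (transportBundle D' e) (transportBundle_fibrewisePicZero D' e) Ĥ
    (wĜ.symm.trans (Category.comp_id _))
    (nonempty_pullbackP_iso_transportBundle_of_nonempty_pullback_map_iso D D' e Ĥ wG wĜ hP)

/-- (K3-a), OVER-FORM: the same with the compatibility stated as `Ĥ ≫ π̂ = π̂'` and the Poincaré clause along the
corresponding `e × Ĥ`. [cite: MilneAV2008, I §8 pp. 36–37] [cite: MumfordFogartyKirwan1994, Ch. 7 §2 Definition 7.3 (p. 130)] -/
theorem eq_hatTransport_of_nonempty_pullback_map_iso' (Ĥ : D'.hat.X.left ⟶ D.hat.X.left)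
    (hĤ : Ĥ ≫ D.hat.X.hom = D'.hat.X.hom)
    (hP : Nonempty ((Scheme.Modules.pullback
      (pullback.map A'.X.hom D'.hat.X.hom A.X.hom D.hat.X.hom e.hom.left Ĥ (𝟙 S)
        (by rw [Category.comp_id, Over.w e.hom]) (by rw [Category.comp_id, hĤ]))).obj D.P ≅ D'.P)) :
    Ĥ = hatTransport D D' e :=
  eq_hatTransport_of_nonempty_pullback_map_iso D D' e Ĥ _ _ hP

end DualPair

end AbelianSchemeOver

end Literature.AlgebraicGeometry.AbelianSchemes

end
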